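import Mathlib.Analysis.Calculus.FDeriv.Equiv
import Mathlib.MeasureTheory.Measure.Haar.NormedSpace
import Literature.Analysis.FluidPDE.SelfSimilar
import HarnessLib

/-!
# Discharge of `Fluid.IsAncientMildSolution.nsRescale` (scale invariance of ancient mild solutions)

`Literature.Analysis.FluidPDE.SelfSimilar` records, as the named fact
`Literature.Analysis.FluidPDE.IsAncientMildSolution.nsRescale`, the scale invariance of ancient mild solutions of
the Navier–Stokes equations on `(-∞, 0) × E` (Koch–Nadirashvili–Seregin–Šverák 2009, §1,
arXiv p. 3: "The scaling symmetry of the equations is `u(x,t) → λu(λx, λ²t)`,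
`p(x,t) → λ²p(λx, λ²t)`"; used for (ancient) mild solutions in §6, arXiv p. 11, where the
rescaled fields `M_k⁻¹ u(x_k + y/M_k, t_k + s/M_k²)` "are mild solutions of the Navier–Stokes
equations", and p. 12, "invariant under the Navier–Stokes scaling"). This file proves it,
`Literature.Analysis.FluidPDE.IsAncientMildSolution.nsRescale_holds`, for the vendored notion
`Fluid.IsAncientMildSolution` (weakly divergence-free slices + the unforced two-time duality
identity of Fabes–Jones–Rivière 1972, Thm. 2.1, `Fluid.IsMildNSSolutionBetween`, between all
`s < t < 0`).

## Proof

Everything is the change of variables `y = c x` in space (Jacobian `c^{-n}`, `n = dim E`;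
Mathlib `MeasureTheory.Measure.integral_comp_smul`) and `σ = c² τ` in time
(`intervalIntegral.integral_comp_mul_left`), both valid without integrability hypotheses
(Mathlib's junk-value conventions for the Bochner integral are scale covariant), together with
three pointwise facts:

* the Gauss–Weierstrass kernel is parabolically self-similar, `K(c²t, cx) = c^{-n} K(t, x)`
  (`heatKernel_sq_mul_smul`), whence the caloric extension, the heat flow and the caloric test
  field are scale covariant: `e^{c²tΔ}(φ(c⁻¹·))(y) = (e^{tΔ}φ)(c⁻¹y)`
  (`heatExtension_comp_inv_smul`, `Fluid.heatFlow_comp_inv_smul`,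
  `Fluid.heatTest_comp_inv_smul`; the junk branches `t ≤ 0` match as well);
* `x ↦ φ(a x)`, `a ≠ 0`, is again a smooth compactly supported (divergence-free) test field
  (`IsTestFunctionOn.comp_smul_top`, `Fluid.IsDivFree.comp_smul`; chain rule
  `fderiv_comp_smul`);
* the pairing of a rescaled field with any `Φ` rescales as
  `∫ ⟪c U(cx), Φ(x)⟫ dx = c · c^{-n} ∫ ⟪U(y), Φ(c⁻¹y)⟫ dy` (`Fluid.integral_inner_nsRescaleData`).

With the test field `ψ = φ(c⁻¹ ·)` every term of the duality identity for `u_c = c u(c²·, c·)`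
between `s` and `t` is `c^{1-n}` times the corresponding term of the identity for `u` between
`c²s` and `c²t` tested against `ψ` (`Fluid.IsMildNSSolutionBetween.nsRescale_zero`; in the
nonlinear term the two chain-rule factors `c` are absorbed by `dσ = c² dτ`), and
`∫ ⟪u_c(t), ∇θ⟫ = c^{2-n} ∫ ⟪u(c²t), ∇(θ(c⁻¹·))⟫ = 0` (`Fluid.IsWeaklyDivFree.nsRescaleData`).
Since `t ↦ c² t` maps `(-∞, 0)` onto itself, `nsRescale c u` is again an ancient mild solution.
The viscosity hypothesis `0 < ν` of the fact is not needed.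

## References

* G. Koch, N. Nadirashvili, G. Seregin, V. Šverák, *Liouville theorems for the Navier–Stokes
  equations and applications*, Acta Math. 203 (2009), 83–105 (doi:10.1007/s11511-009-0039-6,
  arXiv:0709.3599), §1 (scaling symmetry, arXiv p. 3), §6 (ancient mild solutions and the
  rescaling procedure, arXiv pp. 11–12). [KNSS2009]
* E. B. Fabes, B. F. Jones, N. M. Rivière, *The initial value problem for the Navier–Stokes
  equations with data in `L^p`*, Arch. Rational Mech. Anal. 45 (1972), Thm. 2.1 (duality form
  of mild solutions). [FabesJonesRiviere1972]
* L. C. Evans, *Partial Differential Equations*, 2nd ed. (2010), §2.3.1 (the heat kernel).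
  [Evans2010]
* P. G. Lemarié-Rieusset, *The Navier–Stokes Problem in the 21st Century*, CRC Press 2016
  (doi:10.1201/b19556), §4.1 eq. (4.2) (self-similar form of the heat kernel, PDF p. 75), §10.1
  (symmetries: change of scale `v = λu(λ²T, λX)`, `q = λ²p`, force `g = λ³f(λ²T, λX)`, PDF
  pp. 268–269). [LemarieRieusset2016]
* T. Kato, *Strong `L^p`-solutions of the Navier–Stokes equation in `ℝ^m`, with applications to
  weak solutions*, Math. Z. 187 (1984), 471–480, §1 (scaling). [Kato1984]
* J. Barros-Neto, *An Introduction to the Theory of Distributions*, Marcel Dekker 1973, Ch. 1 §1.2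
  (the rescaled test functions `α_ε(x) = ε⁻ⁿα(x/ε)`). [Barrosneto1973]
-/

noncomputable section

open MeasureTheory TopologicalSpace Set Function Module
open scoped InnerProductSpace RealInnerProductSpace ENNReal NNReal

namespace Literature.Analysis.FluidPDE

/-! ### Rescaled test functions -/

section TestFunction

variable {E : Type*} [NormedAddCommGroup E] [NormedSpace ℝ E]
variable {F : Type*} [NormedAddCommGroup F] [NormedSpace ℝ F]

/-- A test function on the whole space composed with a non-degenerate homothety `x ↦ a • x`,
`a ≠ 0`, is a test function on the whole space (smoothness by the chain rule, compact support by
Mathlib's `HasCompactSupport.comp_smul`; the printed instance is the rescaled bump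
`α_ε(x) = ε⁻ⁿ α(x/ε) ∈ C_c^∞(ℝⁿ)` with support the ball of radius `ε`, Barros-Neto 1973, Ch. 1,
§1.2 "Test functions; regularization", between Def. 1.2 and Def. 1.3).
[cite: Barrosneto1973, Ch. 1 §1.2 (between Def. 1.2 and Def. 1.3): α_ε(x) = ε⁻ⁿα(x/ε) ∈ C_c^∞(ℝⁿ)] -/
theorem _root_.Literature.Analysis.FunctionSpaces.IsTestFunctionOn.comp_smul_top {φ : E → F} (hφ : FunctionSpaces.IsTestFunctionOn (⊤ : Opens E) φ)
    {a : ℝ} (ha : a ≠ 0) : FunctionSpaces.IsTestFunctionOn (⊤ : Opens E) (fun x => φ (a • x)) where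
  contDiff := hφ.contDiff.comp (contDiff_const_smul a)
  hasCompactSupport := hφ.hasCompactSupport.comp_smul ha
  tsupport_subset := by simp

end TestFunction

/-! ### Parabolic self-similarity of the heat kernel and of the caloric extension -/

section HeatKernel

variable {E : Type*} [NormedAddCommGroup E] [InnerProductSpace ℝ E]

/-- **Parabolic self-similarity of the Gauss–Weierstrass kernel**: for `0 < c` and `0 < t`,
`K(c²t, c x) = (cⁿ)⁻¹ K(t, x)`, `n = finrank ℝ E` (immediate from
`K(t, x) = (4πt)^{-n/2} exp(-‖x‖²/(4t))`; the self-similar form of the heat kernel,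
`W_t(x) = t^{-3/2} W(x/√t) = (4πt)^{-3/2} e^{-x²/(4t)}` printed for `n = 3` in Lemarié-Rieusset 2016,
§4.1, eq. (4.2); Evans, *PDE*, §2.3.1). [cite: LemarieRieusset2016, §4.1 eq. (4.2) (PDF p. 75)] -/
theorem heatKernel_sq_mul_smul {c : ℝ} (hc : 0 < c) {t : ℝ} (ht : 0 < t) (x : E) :
    UnboundedOperators.heatKernel (c ^ 2 * t) (c • x) = (c ^ Module.finrank ℝ E)⁻¹ * UnboundedOperators.heatKernel t x := by
  unfold UnboundedOperators.heatKernel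
  have h1 : (4 * Real.pi * (c ^ 2 * t)) ^ (-(Module.finrank ℝ E : ℝ) / 2) =
      (c ^ Module.finrank ℝ E)⁻¹ * (4 * Real.pi * t) ^ (-(Module.finrank ℝ E : ℝ) / 2) := by
    rw [show 4 * Real.pi * (c ^ 2 * t) = c ^ 2 * (4 * Real.pi * t) by ring,
      Real.mul_rpow (sq_nonneg c) (by positivity)]
    congr 1
    rw [show (c ^ 2 : ℝ) = c ^ (2 : ℝ) by norm_cast, ← Real.rpow_mul hc.le,
      show (2 : ℝ) * (-(Module.finrank ℝ E : ℝ) / 2) = -(Module.finrank ℝ E : ℝ) by ring,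
      Real.rpow_neg hc.le, Real.rpow_natCast]
  have h2 : -‖c • x‖ ^ 2 / (4 * (c ^ 2 * t)) = -‖x‖ ^ 2 / (4 * t) := by
    rw [norm_smul, Real.norm_of_nonneg hc.le, mul_pow]
    field_simp
  rw [h1, h2, mul_assoc]

variable [FiniteDimensional ℝ E] [MeasurableSpace E] [BorelSpace E]
variable {F : Type*} [NormedAddCommGroup F] [NormedSpace ℝ F]

/-- **Scale covariance of the caloric extension**: for `0 < c` and `0 < t`,
`e^{c²tΔ}(φ(c⁻¹ ·))(y) = (e^{tΔ}φ)(c⁻¹ y)` (substitute `z = c w` in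
`∫ K(c²t, z) φ(c⁻¹(y - z)) dz` and use `heatKernel_sq_mul_smul`; no integrability is needed
since Mathlib's `Measure.integral_comp_inv_smul_of_nonneg` is unconditional); a consequence of
the self-similar form of the heat kernel `W_t(x) = t^{-3/2} W(x/√t)` (Lemarié-Rieusset 2016, §4.1,
eq. (4.2); Evans, *PDE*, §2.3.1). [cite: LemarieRieusset2016, §4.1 eq. (4.2) (PDF p. 75), consequence] -/
theorem heatExtension_comp_inv_smul {c : ℝ} (hc : 0 < c) (φ : E → F) {t : ℝ} (ht : 0 < t)
    (y : E) :
    UnboundedOperators.heatExtension (fun x => φ (c⁻¹ • x)) (c ^ 2 * t) y = UnboundedOperators.heatExtension φ t (c⁻¹ • y) := by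
  rw [UnboundedOperators.heatExtension_apply, UnboundedOperators.heatExtension_apply]
  have h1 : (fun z => UnboundedOperators.heatKernel (c ^ 2 * t) z • φ (c⁻¹ • (y - z))) =
      fun z => (fun w => UnboundedOperators.heatKernel (c ^ 2 * t) (c • w) • φ (c⁻¹ • y - w)) (c⁻¹ • z) := by
    funext z
    simp only [smul_inv_smul₀ hc.ne', smul_sub]
  rw [h1, Measure.integral_comp_inv_smul_of_nonneg volume
    (fun w => UnboundedOperators.heatKernel (c ^ 2 * t) (c • w) • φ (c⁻¹ • y - w)) hc.le]
  have h2 : (fun w => UnboundedOperators.heatKernel (c ^ 2 * t) (c • w) • φ (c⁻¹ • y - w)) =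
      fun w => (c ^ Module.finrank ℝ E)⁻¹ • (UnboundedOperators.heatKernel t w • φ (c⁻¹ • y - w)) := by
    funext w
    rw [heatKernel_sq_mul_smul hc ht, smul_smul]
  rw [h2, integral_smul, smul_smul, mul_inv_cancel₀ (pow_ne_zero _ hc.ne'), one_smul]

/-- Scale covariance of the heat flow `Fluid.heatFlow` for every `t` (for `t ≤ 0` both sides are
the documented junk value `φ (c⁻¹ y)`): `heatFlow (φ(c⁻¹ ·)) (c²t) y = heatFlow φ t (c⁻¹ y)`,
`0 < c` (self-similar form of the heat kernel, Lemarié-Rieusset 2016, §4.1, eq. (4.2); Evans,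
*PDE*, §2.3.1). [cite: LemarieRieusset2016, §4.1 eq. (4.2) (PDF p. 75), consequence] -/
theorem heatFlow_comp_inv_smul {c : ℝ} (hc : 0 < c) (φ : E → F) (t : ℝ) (y : E) :
    FluidPDE.heatFlow (fun x => φ (c⁻¹ • x)) (c ^ 2 * t) y = FluidPDE.heatFlow φ t (c⁻¹ • y) := by
  rcases le_or_gt t 0 with ht | ht
  · rw [FluidPDE.heatFlow_of_nonpos _ ht,
      FluidPDE.heatFlow_of_nonpos _ (mul_nonpos_of_nonneg_of_nonpos (sq_nonneg c) ht)]
  · rw [FluidPDE.heatFlow_of_pos _ ht, FluidPDE.heatFlow_of_pos _ (mul_pos (pow_pos hc 2) ht),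
      heatExtension_comp_inv_smul hc φ ht]

/-- Scale covariance of the caloric test field: `e^{ν c²τ Δ}(φ(c⁻¹ ·))(y) = (e^{ντΔ}φ)(c⁻¹ y)`
for `0 < c` and all `ν`, `τ` (Fabes–Jones–Rivière 1972, §2; self-similar form of the heat kernel,
Lemarié-Rieusset 2016, §4.1, eq. (4.2); Evans, *PDE*, §2.3.1).
[cite: LemarieRieusset2016, §4.1 eq. (4.2) (PDF p. 75), consequence] -/
theorem heatTest_comp_inv_smul {c : ℝ} (hc : 0 < c) (ν : ℝ) (φ : E → F) (τ : ℝ) (y : E) :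
    FluidPDE.heatTest ν (fun x => φ (c⁻¹ • x)) (c ^ 2 * τ) y = FluidPDE.heatTest ν φ τ (c⁻¹ • y) := by
  show FluidPDE.heatFlow _ (ν * (c ^ 2 * τ)) y = FluidPDE.heatFlow φ (ν * τ) (c⁻¹ • y)
  rw [mul_left_comm, FluidPDE.heatFlow_comp_inv_smul hc]

end HeatKernel

section Fluid

/-! ### Rescaling of divergence-free fields and of pairings -/

section Pairing

variable {E : Type*} [NormedAddCommGroup E] [InnerProductSpace ℝ E] [FiniteDimensional ℝ E]

omit [FiniteDimensional ℝ E] in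
/-- A (pointwise) divergence-free field composed with a homothety is divergence free:
`div (φ(a ·))(x) = a (div φ)(a x) = 0` (chain rule, Mathlib `fderiv_comp_smul`, and linearity
of the trace; the change of scale `X = x/λ`, `v(T,X) = λu(λ²T, λX)` is a symmetry of the
Navier–Stokes system including `div u = 0`, Lemarié-Rieusset 2016, §10.1; KNSS 2009, §1, arXiv p. 3).
[cite: LemarieRieusset2016, §10.1 (PDF pp. 268–269): change of scale] -/
theorem VectorCalculus.IsDivFree.comp_smul {φ : E → E} (h : VectorCalculus.IsDivFree φ) (a : ℝ) :
    VectorCalculus.IsDivFree (fun x => φ (a • x)) := by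
  intro x
  have hx := h (a • x)
  simp only [VectorCalculus.divergence] at hx ⊢
  rw [fderiv_comp_smul, ContinuousLinearMap.toLinearMap_smul, map_smul, hx, smul_zero]

/-- `⟪v, ∇θ(x)⟫ = Dθ(x) v` (Riesz representation of the Fréchet derivative; Mathlib
`InnerProductSpace.toDual_symm_apply`). [folklore] -/
theorem real_inner_gradient_right (θ : E → ℝ) (x v : E) :
    ⟪v, gradient θ x⟫ = fderiv ℝ θ x v := by
  rw [gradient, real_inner_comm, InnerProductSpace.toDual_symm_apply]

variable [MeasurableSpace E] [BorelSpace E]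

/-- **Rescaling of pairings**: for `0 < c` and any fields `U, Φ : E → E`,
`∫ ⟪c U(c x), Φ(x)⟫ dx = c (cⁿ)⁻¹ ∫ ⟪U(y), Φ(c⁻¹ y)⟫ dy`, `n = finrank ℝ E` (substitute
`y = c x`; unconditional, by Mathlib's `Measure.integral_comp_smul`). [folklore] -/
theorem integral_inner_nsRescaleData {c : ℝ} (hc : 0 < c) (U Φ : E → E) :
    ∫ x, ⟪nsRescaleData c U x, Φ x⟫ =
      c * (c ^ Module.finrank ℝ E)⁻¹ * ∫ y, ⟪U y, Φ (c⁻¹ • y)⟫ := by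
  have h1 : (fun x => ⟪nsRescaleData c U x, Φ x⟫) =
      fun x => (fun y => c * ⟪U y, Φ (c⁻¹ • y)⟫) (c • x) := by
    funext x
    simp only [nsRescaleData_apply, real_inner_smul_left, inv_smul_smul₀ hc.ne']
  rw [h1, Measure.integral_comp_smul volume (fun y => c * ⟪U y, Φ (c⁻¹ • y)⟫) c,
    integral_const_mul, smul_eq_mul, abs_of_nonneg (inv_nonneg.2 (pow_nonneg hc.le _))]
  ring

/-- **Weak divergence-freeness is scale invariant**: if `∫ ⟪U, ∇θ⟫ = 0` for all test functions
`θ`, then the same holds for `x ↦ c U(c x)`, `0 < c` (test against `θ(c⁻¹ ·)` and change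
variables; `∇θ(c⁻¹ y) = c ∇(θ(c⁻¹ ·))(y)`). [folklore] -/
theorem IsWeaklyDivFree.nsRescaleData {U : E → E} (h : IsWeaklyDivFree U) {c : ℝ} (hc : 0 < c) :
    IsWeaklyDivFree (nsRescaleData c U) := by
  intro θ hθ
  have hc' : c ≠ 0 := hc.ne'
  have key := h (fun y => θ (c⁻¹ • y)) (hθ.comp_smul_top (inv_ne_zero hc'))
  rw [integral_inner_nsRescaleData hc]
  have h2 : ∀ y, ⟪U y, gradient θ (c⁻¹ • y)⟫ =
      c * ⟪U y, gradient (fun y => θ (c⁻¹ • y)) y⟫ := by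
    intro y
    rw [real_inner_gradient_right, real_inner_gradient_right, fderiv_comp_smul, smul_apply,
      smul_eq_mul, ← mul_assoc, mul_inv_cancel₀ hc', one_mul]
  simp_rw [h2]
  rw [integral_const_mul, key, mul_zero, mul_zero]

end Pairing

/-! ### Scale invariance of the duality identity and of ancient mild solutions -/

section Mild

variable {E : Type*} [NormedAddCommGroup E] [InnerProductSpace ℝ E] [FiniteDimensional ℝ E]
  [MeasurableSpace E] [BorelSpace E]

/-- **Scale invariance of the unforced two-time duality identity**: if the duality identity
(Fabes–Jones–Rivière 1972, Thm. 2.1) holds for `u` between `c²s` and `c²t`, then it holds for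
the rescaled field `nsRescale c u = c u(c²·, c·)` between `s` and `t`, `0 < c`: every term is
`c (cⁿ)⁻¹` times the corresponding term for `u` tested against `φ(c⁻¹ ·)` (KNSS 2009, §1: the
scaling `u(x,t) → λu(λx, λ²t)` is a symmetry of the equations). No hypothesis on `ν`. [cite: KNSS2009, §1] -/
theorem IsMildNSSolutionBetween.nsRescale_zero {ν : ℝ} {u : ℝ → E → E} {s t c : ℝ} (hc : 0 < c)
    (h : IsMildNSSolutionBetween ν 0 u (c ^ 2 * s) (c ^ 2 * t)) :
    IsMildNSSolutionBetween ν 0 (FluidPDE.nsRescale c u) s t := by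
  intro φ hφ hdiv
  have hc' : c ≠ 0 := hc.ne'
  have hc2 : c ^ 2 ≠ 0 := pow_ne_zero 2 hc'
  -- the duality identity for `u` between `c²s` and `c²t`, tested against `φ(c⁻¹ ·)`
  have key := h (fun y => φ (c⁻¹ • y)) (hφ.comp_smul_top (inv_ne_zero hc'))
    (hdiv.comp_smul c⁻¹)
  -- the force terms vanish
  simp only [Pi.zero_apply, inner_zero_left, integral_zero, intervalIntegral.integral_zero,
    add_zero] at key ⊢
  -- slices of the rescaled field are rescaled data
  have hslice : ∀ τ, FluidPDE.nsRescale c u τ = nsRescaleData c (u (c ^ 2 * τ)) := fun τ => rfl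
  -- left-hand side
  have e1 : ∫ x, ⟪FluidPDE.nsRescale c u t x, φ x⟫ =
      c * (c ^ Module.finrank ℝ E)⁻¹ * ∫ y, ⟪u (c ^ 2 * t) y, φ (c⁻¹ • y)⟫ := by
    rw [hslice, integral_inner_nsRescaleData hc]
  -- datum term
  have e2 : ∫ x, ⟪FluidPDE.nsRescale c u s x, heatTest ν φ (t - s) x⟫ =
      c * (c ^ Module.finrank ℝ E)⁻¹ *
        ∫ y, ⟪u (c ^ 2 * s) y, heatTest ν (fun y => φ (c⁻¹ • y)) (c ^ 2 * t - c ^ 2 * s) y⟫ := by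
    rw [hslice, integral_inner_nsRescaleData hc, ← mul_sub]
    simp_rw [← heatTest_comp_inv_smul hc ν φ (t - s)]
  -- nonlinear term, slice by slice
  have e3 : ∀ τ,
      ∫ x, ⟪FluidPDE.nsRescale c u τ x, convect (FluidPDE.nsRescale c u τ) (heatTest ν φ (t - τ)) x⟫ =
      c * (c ^ Module.finrank ℝ E)⁻¹ * (c ^ 2 * ∫ y, ⟪u (c ^ 2 * τ) y,
        convect (u (c ^ 2 * τ)) (heatTest ν (fun y => φ (c⁻¹ • y)) (c ^ 2 * t - c ^ 2 * τ)) y⟫) := by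
    intro τ
    have hW : heatTest ν φ (t - τ) =
        fun x => heatTest ν (fun y => φ (c⁻¹ • y)) (c ^ 2 * (t - τ)) (c • x) := by
      funext x
      rw [heatTest_comp_inv_smul hc, inv_smul_smul₀ hc']
    rw [hslice, integral_inner_nsRescaleData hc, ← integral_const_mul (c ^ 2), ← mul_sub]
    congr 1
    refine integral_congr_ae (ae_of_all _ fun y => ?_)
    simp only [convect_apply, nsRescaleData_apply, smul_inv_smul₀ hc', map_smul,
      real_inner_smul_right]
    rw [hW, fderiv_comp_smul, smul_inv_smul₀ hc', smul_apply, real_inner_smul_right,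
      ← mul_assoc, ← sq]
  -- change of the time variable `σ = c² τ` in the nonlinear term
  have e4 := intervalIntegral.integral_comp_mul_left (a := s) (b := t)
    (fun σ => ∫ y, ⟪u σ y,
      convect (u σ) (heatTest ν (fun y => φ (c⁻¹ • y)) (c ^ 2 * t - σ)) y⟫) hc2
  beta_reduce at e4
  simp_rw [e3]
  rw [e1, e2, intervalIntegral.integral_const_mul, intervalIntegral.integral_const_mul, e4,
    smul_eq_mul, ← mul_assoc (c ^ 2), mul_inv_cancel₀ hc2, one_mul, key, mul_add]

/-- **Discharge of `IsAncientMildSolution.nsRescale`** (Koch–Nadirashvili–Seregin–Šverák 2009,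
§1: the Navier–Stokes scaling `u(x,t) → λu(λx, λ²t)` is a symmetry of the equations; §6: the
rescaled fields of the blow-up procedure "are mild solutions", limits are ancient mild
solutions): for `0 < c` the parabolic rescaling `nsRescale c u` of an ancient mild solution is
an ancient mild solution — `t ↦ c²t` maps `(-∞, 0)` onto itself, weak divergence-freeness is
scale invariant (`IsWeaklyDivFree.nsRescaleData`) and so is the unforced duality identity
(`IsMildNSSolutionBetween.nsRescale_zero`). The hypothesis `0 < ν` is not used. [cite: KNSS2009, §1 and §6] -/
theorem IsAncientMildSolution.nsRescale_holds {ν : ℝ} {u : ℝ → E → E} :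
    IsAncientMildSolution.nsRescale (ν := ν) (u := u) := by
  intro h _ c hc
  refine ⟨fun t ht => ?_, fun s t hst ht => ?_⟩
  · exact (h.1 (c ^ 2 * t) (mul_neg_of_pos_of_neg (by positivity) ht)).nsRescaleData hc
  · refine IsMildNSSolutionBetween.nsRescale_zero hc (h.2 _ _ ?_ ?_)
    · exact mul_lt_mul_of_pos_left hst (by positivity)
    · exact mul_neg_of_pos_of_neg (by positivity) ht

/-- **Scale invariance of the forced two-time duality identity**: if the duality identity
(Fabes–Jones–Rivière 1972, Thm. 2.1) with force `f` holds for `u` between `c²s` and `c²t`, then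
it holds for the rescaled field `nsRescale c u = c u(c²·, c·)` with the rescaled force
`nsRescaleForce c f = c³ f(c²·, c·)` between `s` and `t`, `0 < c`: every term is `c (cⁿ)⁻¹`
times the corresponding term for `u` tested against `φ(c⁻¹ ·)` — in the nonlinear and force
terms the extra factor `c²` (two chain-rule factors `c`, resp. `c³ = c · c²`) is absorbed by
`dσ = c² dτ` (Kato 1984, §1; Caffarelli–Kohn–Nirenberg 1982, (1.5)–(1.6): the scaling
`u(x,t) → λu(λx, λ²t)`, `f → λ³f(λx, λ²t)` is a symmetry of the equations). No hypothesis on `ν`.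
[cite: Kato1984, §1] -/
theorem IsMildNSSolutionBetween.nsRescale_sq_mul {ν : ℝ} {f u : ℝ → E → E} {s t c : ℝ}
    (hc : 0 < c) (h : IsMildNSSolutionBetween ν f u (c ^ 2 * s) (c ^ 2 * t)) :
    IsMildNSSolutionBetween ν (nsRescaleForce c f) (FluidPDE.nsRescale c u) s t := by
  intro φ hφ hdiv
  have hc' : c ≠ 0 := hc.ne'
  have hc2 : c ^ 2 ≠ 0 := pow_ne_zero 2 hc'
  -- the duality identity for `u` between `c²s` and `c²t`, tested against `φ(c⁻¹ ·)`
  have key := h (fun y => φ (c⁻¹ • y)) (hφ.comp_smul_top (inv_ne_zero hc'))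
    (hdiv.comp_smul c⁻¹)
  -- slices of the rescaled field are rescaled data; the rescaled force is `c²` times rescaled data
  have hslice : ∀ τ, FluidPDE.nsRescale c u τ = nsRescaleData c (u (c ^ 2 * τ)) := fun τ => rfl
  have hforce : ∀ τ x, nsRescaleForce c f τ x = c ^ 2 • nsRescaleData c (f (c ^ 2 * τ)) x := by
    intro τ x
    rw [nsRescaleForce_apply, nsRescaleData_apply, smul_smul, ← pow_succ]
  -- the rescaled caloric test field
  have hW : ∀ τ, heatTest ν φ (t - τ) =
      fun x => heatTest ν (fun y => φ (c⁻¹ • y)) (c ^ 2 * (t - τ)) (c • x) := by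
    intro τ
    funext x
    rw [heatTest_comp_inv_smul hc, inv_smul_smul₀ hc']
  -- left-hand side
  have e1 : ∫ x, ⟪FluidPDE.nsRescale c u t x, φ x⟫ =
      c * (c ^ Module.finrank ℝ E)⁻¹ * ∫ y, ⟪u (c ^ 2 * t) y, φ (c⁻¹ • y)⟫ := by
    rw [hslice, integral_inner_nsRescaleData hc]
  -- datum term
  have e2 : ∫ x, ⟪FluidPDE.nsRescale c u s x, heatTest ν φ (t - s) x⟫ =
      c * (c ^ Module.finrank ℝ E)⁻¹ *
        ∫ y, ⟪u (c ^ 2 * s) y, heatTest ν (fun y => φ (c⁻¹ • y)) (c ^ 2 * t - c ^ 2 * s) y⟫ := by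
    rw [hslice, integral_inner_nsRescaleData hc, ← mul_sub]
    simp_rw [← heatTest_comp_inv_smul hc ν φ (t - s)]
  -- nonlinear term, slice by slice
  have e3 : ∀ τ,
      ∫ x, ⟪FluidPDE.nsRescale c u τ x, convect (FluidPDE.nsRescale c u τ) (heatTest ν φ (t - τ)) x⟫ =
      c * (c ^ Module.finrank ℝ E)⁻¹ * (c ^ 2 * ∫ y, ⟪u (c ^ 2 * τ) y,
        convect (u (c ^ 2 * τ)) (heatTest ν (fun y => φ (c⁻¹ • y)) (c ^ 2 * t - c ^ 2 * τ)) y⟫) := by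
    intro τ
    rw [hslice, integral_inner_nsRescaleData hc, ← integral_const_mul (c ^ 2), ← mul_sub]
    congr 1
    refine integral_congr_ae (ae_of_all _ fun y => ?_)
    simp only [convect_apply, nsRescaleData_apply, smul_inv_smul₀ hc', map_smul,
      real_inner_smul_right]
    rw [hW τ, fderiv_comp_smul, smul_inv_smul₀ hc', smul_apply, real_inner_smul_right,
      ← mul_assoc, ← sq]
  -- force term, slice by slice
  have e5 : ∀ τ,
      ∫ x, ⟪nsRescaleForce c f τ x, heatTest ν φ (t - τ) x⟫ =
      c * (c ^ Module.finrank ℝ E)⁻¹ * (c ^ 2 * ∫ y, ⟪f (c ^ 2 * τ) y,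
        heatTest ν (fun y => φ (c⁻¹ • y)) (c ^ 2 * t - c ^ 2 * τ) y⟫) := by
    intro τ
    have h1 : (fun x => ⟪nsRescaleForce c f τ x, heatTest ν φ (t - τ) x⟫) =
        fun x => c ^ 2 * ⟪nsRescaleData c (f (c ^ 2 * τ)) x, heatTest ν φ (t - τ) x⟫ := by
      funext x
      rw [hforce, real_inner_smul_left]
    rw [h1, integral_const_mul, integral_inner_nsRescaleData hc, ← mul_sub]
    have h2 : ∀ y, heatTest ν φ (t - τ) (c⁻¹ • y) =
        heatTest ν (fun y => φ (c⁻¹ • y)) (c ^ 2 * (t - τ)) y := by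
      intro y
      rw [hW τ]
      simp only [smul_inv_smul₀ hc']
    simp_rw [h2]
    ring
  -- change of the time variable `σ = c² τ` in the nonlinear and force terms
  have E3 : (∫ τ in s..t, ∫ x, ⟪FluidPDE.nsRescale c u τ x,
      convect (FluidPDE.nsRescale c u τ) (heatTest ν φ (t - τ)) x⟫) =
      c * (c ^ Module.finrank ℝ E)⁻¹ * ∫ σ in (c ^ 2 * s)..(c ^ 2 * t), ∫ y, ⟪u σ y,
        convect (u σ) (heatTest ν (fun y => φ (c⁻¹ • y)) (c ^ 2 * t - σ)) y⟫ := by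
    have e4 := intervalIntegral.integral_comp_mul_left (a := s) (b := t)
      (fun σ => ∫ y, ⟪u σ y,
        convect (u σ) (heatTest ν (fun y => φ (c⁻¹ • y)) (c ^ 2 * t - σ)) y⟫) hc2
    beta_reduce at e4
    simp_rw [e3]
    rw [intervalIntegral.integral_const_mul, intervalIntegral.integral_const_mul, e4, smul_eq_mul,
      ← mul_assoc (c ^ 2), mul_inv_cancel₀ hc2, one_mul]
  have E5 : (∫ τ in s..t, ∫ x, ⟪nsRescaleForce c f τ x, heatTest ν φ (t - τ) x⟫) =
      c * (c ^ Module.finrank ℝ E)⁻¹ * ∫ σ in (c ^ 2 * s)..(c ^ 2 * t), ∫ y, ⟪f σ y,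
        heatTest ν (fun y => φ (c⁻¹ • y)) (c ^ 2 * t - σ) y⟫ := by
    have e6 := intervalIntegral.integral_comp_mul_left (a := s) (b := t)
      (fun σ => ∫ y, ⟪f σ y, heatTest ν (fun y => φ (c⁻¹ • y)) (c ^ 2 * t - σ) y⟫) hc2
    beta_reduce at e6
    simp_rw [e5]
    rw [intervalIntegral.integral_const_mul, intervalIntegral.integral_const_mul, e6, smul_eq_mul,
      ← mul_assoc (c ^ 2), mul_inv_cancel₀ hc2, one_mul]
  rw [e1, e2, E3, E5, key, mul_add, mul_add]

/-- **Discharge of `IsMildNSSolutionBetween.nsRescale`** (Kato 1984, §1; Lemarié-Rieusset 2002,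
Ch. 11; Caffarelli–Kohn–Nirenberg 1982, (1.5)–(1.6)): if `u` is a mild (duality-form) solution
between `s` and `t` with force `f`, then `nsRescale c u` is a mild solution between `c⁻²s` and
`c⁻²t` with force `nsRescaleForce c f`, `0 < c` (`IsMildNSSolutionBetween.nsRescale_sq_mul` with
`s = c²(s/c²)`, `t = c²(t/c²)`). The hypothesis `0 < ν` of the fact is not used. [cite: Kato1984, §1] -/
theorem IsMildNSSolutionBetween.nsRescale_holds :
    IsMildNSSolutionBetween.nsRescale (E := E) := by
  intro ν f u s t h _ c hc
  have hc2 : c ^ 2 ≠ 0 := pow_ne_zero 2 hc.ne'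
  refine IsMildNSSolutionBetween.nsRescale_sq_mul hc ?_
  rwa [mul_div_cancel₀ s hc2, mul_div_cancel₀ t hc2]

end Mild

end Fluid

end Literature.Analysis.FluidPDE
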